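import Summits.Schanuel.Schanuel.Theorems.RootDecomp1KHyper06

/-!
# RootDecomp1KHyper — part 7 of the «HyperCarving» port wave (lens 6, gen 9 = ROUND 4 of route-Schanuel-RootDecomp1K; 19 parts planned)

Mechanical port (census-1 gen 7, dependency closure; tools census/tools/gen7/portkit2.py + build_l6g9.py) of §17 of HOME/decomp-schanuel-lens-6/g9/HyperCarving.lean
(sha256 aba5c91f…, 8041 l; critic CLEARED FOR TYPING 2026-08-30T13:33:07Z; writer PATH A″ rev 5–8) together with the §§0–16 declarations it depends on
(nothing of the node was in the tree before except RootDecomp1KLinLiouvilleSplit and the Literature fact NesterenkoWaldschmidt1996_thm_5_1).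
This part: node lines 4073–4176 (2 declarations: endgame, eval_map_intCast).
All parts share the namespace `Summit.Schanuel.Schanuel.Theorems.RootDecomp1KHyper` (node sub-namespace `HyperCell` reproduced); statements and proofs
are the node's verbatim; `--supports stmt-Schanuel-33363` (A₄ʰ HyperLiouvilleSchanuel). Sorry-free; standard axioms. Nothing here proves Schanuel; rung 0.
-/

set_option linter.dupNamespace false
set_option linter.unusedSectionVars false

noncomputable section

open Complex IntermediateField Filter Polynomial

namespace Summit.Schanuel.Schanuel.Theorems.RootDecomp1KHyper

variable {n K : ℕ}

namespace HyperCell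

variable {n K : ℕ}

/-- `x · e^{−x} ≤ 1`. -/
private theorem mul_exp_neg_le_one (x : ℝ) : x * Real.exp (-x) ≤ 1 := by
  rw [Real.exp_neg, ← div_eq_mul_inv, div_le_one (Real.exp_pos x)]
  linarith [Real.add_one_le_exp x]

/-- The endgame in real numbers: the measure's lower bound `exp(−Φ)`, `Φ ≤ c q³`, against the
two upper bounds `2e^{|ρ|} η` (moving the exponent) and `δ` with `δ^K ≤ q^D M η` (the nearby
root), where `η < exp(−q^m)` and `q^m ≥ C q³` with `C ≥ K c + K + D + M + |ρ| + 3`. -/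
theorem endgame {K D q m : ℕ} {ρ c M η δ Φ C : ℝ} (hK : 1 ≤ K) (hq : 1 ≤ q) (hc : 0 ≤ c)
    (hM : 0 ≤ M)
    (hlow : Real.exp (-Φ) ≤ 2 * Real.exp |ρ| * η + δ) (hΦ : Φ ≤ c * (q : ℝ) ^ 3)
    (hδ : δ ^ K ≤ (q : ℝ) ^ D * M * η) (hη : η < Real.exp (-((q : ℝ) ^ m)))
    (hC : (K : ℝ) * c + K + D + M + |ρ| + 3 ≤ C) (hqm : C * (q : ℝ) ^ 3 ≤ (q : ℝ) ^ m) : False := by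
  set E : ℝ := Real.exp (-(c * (q : ℝ) ^ 3)) with hE
  have hE0 : 0 < E := Real.exp_pos _
  have hEΦ : E ≤ Real.exp (-Φ) := Real.exp_le_exp.mpr (by linarith)
  have hq3 : (1 : ℝ) ≤ (q : ℝ) ^ 3 := one_le_pow₀ (by exact_mod_cast hq)
  have hq1r : (1 : ℝ) ≤ q := by exact_mod_cast hq
  have hKr : (1 : ℝ) ≤ K := by exact_mod_cast hK
  -- the exponent q^m dominates everything
  have hmain : (K : ℝ) * c * (q : ℝ) ^ 3 + K * (q : ℝ) ^ 3 + D * (q : ℝ) ^ 3 + M * (q : ℝ) ^ 3 +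
      |ρ| * (q : ℝ) ^ 3 + 3 * (q : ℝ) ^ 3 ≤ (q : ℝ) ^ m := by
    have h1 : ((K : ℝ) * c + K + D + M + |ρ| + 3) * (q : ℝ) ^ 3 ≤ (q : ℝ) ^ m :=
      le_trans (mul_le_mul_of_nonneg_right hC (by positivity)) hqm
    have hexp : ((K : ℝ) * c + K + D + M + |ρ| + 3) * (q : ℝ) ^ 3 =
        (K : ℝ) * c * (q : ℝ) ^ 3 + K * (q : ℝ) ^ 3 + D * (q : ℝ) ^ 3 + M * (q : ℝ) ^ 3 +
          |ρ| * (q : ℝ) ^ 3 + 3 * (q : ℝ) ^ 3 := by ring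
    rwa [hexp] at h1
  have hx : ∀ x : ℝ, 0 ≤ x → x ≤ x * (q : ℝ) ^ 3 := fun x hx0 => le_mul_of_one_le_right hx0 hq3
  have e1 : c * (q : ℝ) ^ 3 ≤ (K : ℝ) * c * (q : ℝ) ^ 3 := by
    have : 0 ≤ c * (q : ℝ) ^ 3 := by positivity
    nlinarith
  have e2 := hx |ρ| (abs_nonneg ρ)
  have e3 := hx M hM
  have e4 := hx (K : ℝ) (by positivity)
  have e6 : (D : ℝ) * q ≤ D * (q : ℝ) ^ 3 := by
    refine mul_le_mul_of_nonneg_left ?_ (by positivity)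
    calc (q : ℝ) = (q : ℝ) ^ 1 := (pow_one _).symm
      _ ≤ (q : ℝ) ^ 3 := pow_le_pow_right₀ hq1r (by norm_num)
  have hdom1 : c * (q : ℝ) ^ 3 + |ρ| + 3 ≤ (q : ℝ) ^ m := by
    have : 0 ≤ (K : ℝ) * (q : ℝ) ^ 3 + D * (q : ℝ) ^ 3 + M * (q : ℝ) ^ 3 := by positivity
    linarith
  have hdom2 : (K : ℝ) * c * (q : ℝ) ^ 3 + K + D * q + M ≤ (q : ℝ) ^ m := by
    have : 0 ≤ |ρ| * (q : ℝ) ^ 3 + 3 * (q : ℝ) ^ 3 := by positivity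
    linarith
  -- claim 1: the exponent-moving term is < E/2
  have h1 : 2 * Real.exp |ρ| * η < E / 2 := by
    have hηb : η < Real.exp (-(c * (q : ℝ) ^ 3 + |ρ| + 3)) := by
      refine hη.trans_le (Real.exp_le_exp.mpr ?_)
      linarith
    have hsplit : Real.exp (-(c * (q : ℝ) ^ 3 + |ρ| + 3)) = E * Real.exp (-|ρ|) * Real.exp (-3) := by
      rw [hE, ← Real.exp_add, ← Real.exp_add]; congr 1; ring
    have he3 : Real.exp (-3 : ℝ) < 1 / 4 := by
      rw [Real.exp_neg, ← one_div]
      refine one_div_lt_one_div_of_lt (by norm_num) ?_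
      have := Real.add_one_lt_exp (by norm_num : (3 : ℝ) ≠ 0)
      linarith
    have hpos : 0 < 2 * Real.exp |ρ| := by positivity
    calc 2 * Real.exp |ρ| * η < 2 * Real.exp |ρ| * (E * Real.exp (-|ρ|) * Real.exp (-3)) := by
          rw [← hsplit]; exact mul_lt_mul_of_pos_left hηb hpos
      _ = 2 * (Real.exp |ρ| * Real.exp (-|ρ|)) * E * Real.exp (-3) := by ring
      _ = 2 * E * Real.exp (-3) := by rw [← Real.exp_add, add_neg_cancel, Real.exp_zero]; ring
      _ < 2 * E * (1 / 4) := by gcongr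
      _ = E / 2 := by ring
  -- claim 2: the nearby root is within E/2
  have h2 : δ < E / 2 := by
    by_contra hge
    push Not at hge
    have hpow : (E / 2) ^ K ≤ δ ^ K := pow_le_pow_left₀ (by positivity) hge K
    -- but δ^K ≤ q^D M η < (E/2)^K
    have hηb : η < Real.exp (-((K : ℝ) * c * (q : ℝ) ^ 3 + K + D * q + M)) := by
      refine hη.trans_le (Real.exp_le_exp.mpr ?_)
      linarith
    have hsplit : Real.exp (-((K : ℝ) * c * (q : ℝ) ^ 3 + K + D * q + M)) =
        E ^ K * Real.exp (-(K : ℝ)) * Real.exp (-(D * q : ℝ)) * Real.exp (-M) := by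
      rw [hE, ← Real.exp_nat_mul, ← Real.exp_add, ← Real.exp_add, ← Real.exp_add]
      congr 1; ring
    have hqD : (q : ℝ) ^ D * Real.exp (-(D * q : ℝ)) ≤ 1 := by
      have : Real.exp (-(D * q : ℝ)) = Real.exp (-(q : ℝ)) ^ D := by
        rw [← Real.exp_nat_mul]; congr 1; ring
      rw [this, ← mul_pow]
      exact pow_le_one₀ (by positivity) (mul_exp_neg_le_one _)
    have hMM : M * Real.exp (-M) ≤ 1 := mul_exp_neg_le_one M
    have hK2 : Real.exp (-(K : ℝ)) ≤ (1 / 2) ^ K := by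
      have : Real.exp (-(K : ℝ)) = Real.exp (-1) ^ K := by
        rw [← Real.exp_nat_mul]; congr 1; ring
      rw [this]
      refine pow_le_pow_left₀ (by positivity) ?_ K
      rw [Real.exp_neg]
      have := Real.add_one_le_exp (1 : ℝ)
      rw [← one_div]
      exact one_div_le_one_div_of_le (by norm_num) (by linarith)
    have hlt : (q : ℝ) ^ D * M * η < (E / 2) ^ K := by
      rcases eq_or_lt_of_le hM with hM0 | hMpos
      · rw [← hM0, mul_zero, zero_mul]; positivity
      calc (q : ℝ) ^ D * M * η
          < (q : ℝ) ^ D * M * (E ^ K * Real.exp (-(K : ℝ)) * Real.exp (-(D * q : ℝ)) * Real.exp (-M)) := by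
            rw [← hsplit]; exact mul_lt_mul_of_pos_left hηb (by positivity)
        _ = E ^ K * Real.exp (-(K : ℝ)) * ((q : ℝ) ^ D * Real.exp (-(D * q : ℝ))) * (M * Real.exp (-M)) := by
            ring
        _ ≤ E ^ K * (1 / 2) ^ K * 1 * 1 := by gcongr
        _ = (E / 2) ^ K := by rw [← mul_pow]; ring
    linarith
  linarith

/-- §16d. The theorem: auxiliary statement `eval_map_intCast` (lens 6 gen 9 node, ported verbatim). -/
private theorem eval_map_intCast (P : ℤ[X]) (x : ℂ) : (P.map (Int.castRingHom ℂ)).eval x = aeval x P := by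
  rw [Polynomial.eval_map, Polynomial.aeval_def, algebraMap_int_eq]

end HyperCell

end Summit.Schanuel.Schanuel.Theorems.RootDecomp1KHyper
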